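import Summits.KontsevichZagierPeriods.Zeta5Search.LaiSweepEngine

/-!
# Order-cell sweep certificates for the `κ₃` point, 2/6: base/jump split and prefix bound

HONEST FRAMING. Systematic-search bookkeeping for the `κ₃` point `(74, 2180, 444; δ74)` of
`LaiKappa3Assembly`; no irrationality claim unless certified — this file checks no shard of the `κ₃`
sweep and proves nothing about `ζ(5)`.

For `y ∈ [0, 1)`: `⌊y − a x⌋ = −⌊a x⌋ − 1 + 1[y ≥ {a x}]` and `⌊a x − y⌋ = ⌊a x⌋ − 1[y > {a x}]`, so
every term of `φ̃` is a `y`-free base part plus a jump (`eval_eq_base_add_jump`); if the passed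
jumps form a down-set of a list order then their weight sum is at least the list's min-prefix
(`minPrefixD_le`); at the left endpoint `u = p/q` the order by the keys `keyU = (q·{a u}, type)` has
this property (`passed_mono_U`); and the decoration `deco` computes the keys (`deco_ok`).

## Main results

* `Sweep.flfr_fst`, `Sweep.flfr_snd`: the engine's floor / fractional part are `⌊a p/q⌋`, `{a p/q}`.
* `Sweep.eval_eq_base_add_jump`, `Sweep.minPrefixD_le`, `Sweep.passed_mono_U`, `Sweep.deco_ok`.
-/

open Finset Literature.NumberTheory.Transcendental.Zudilin2004
open Literature.NumberTheory.Transcendental.Zudilin2004.PhiCert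

namespace Summit.KontsevichZagierPeriods.Zeta5Search

open SavingCheck

namespace Sweep

/-! ### Soundness, I: the arithmetic of one term -/

/-- `flfr` computes `⌊a p/q⌋` and `q · {a p/q}`. [folklore] -/
theorem flfr_spec (a : ℤ) (p q : ℕ) (hq : 0 < q) :
    ((flfr a p q).1 : ℚ) + ((flfr a p q).2 : ℚ) / q = (a : ℚ) * p / q ∧ (flfr a p q).2 < q := by
  have hq' : (0 : ℚ) < q := by exact_mod_cast hq
  cases a with
  | ofNat k =>
    refine ⟨?_, Nat.mod_lt _ hq⟩
    have h : ((q * (k * p / q) + k * p % q : ℕ) : ℚ) = ((k * p : ℕ) : ℚ) := by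
      exact_mod_cast Nat.div_add_mod (k * p) q
    push_cast at h
    simp only [flfr, Int.ofNat_eq_natCast, Int.cast_natCast]
    field_simp
    linarith
  | negSucc k =>
    have hk : ((Int.negSucc k : ℤ) : ℚ) = -((k : ℚ) + 1) := by
      rw [Int.negSucc_eq]; push_cast; ring
    have h : ((q * ((k + 1) * p / q) + (k + 1) * p % q : ℕ) : ℚ) = (((k + 1) * p : ℕ) : ℚ) := by
      exact_mod_cast Nat.div_add_mod ((k + 1) * p) q
    push_cast at h
    by_cases h0 : (k + 1) * p % q = 0
    · simp only [flfr, h0, ↓reduceIte, Int.cast_neg, Int.cast_natCast, Nat.cast_zero, zero_div,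
        add_zero, hk]
      refine ⟨?_, hq⟩
      rw [h0, Nat.cast_zero, add_zero] at h
      field_simp
      linarith
    · simp only [flfr, h0, ↓reduceIte, Int.cast_sub, Int.cast_neg, Int.cast_natCast, Int.cast_one,
        hk]
      have hlt : (k + 1) * p % q < q := Nat.mod_lt _ hq
      refine ⟨?_, by omega⟩
      rw [Nat.cast_sub hlt.le]
      field_simp
      linarith

/-- The first component of `flfr` is the floor. [folklore] -/
theorem flfr_fst (a : ℤ) (p q : ℕ) (hq : 0 < q) : (flfr a p q).1 = ⌊(a : ℚ) * p / q⌋ := by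
  obtain ⟨h, hlt⟩ := flfr_spec a p q hq
  have hq' : (0 : ℚ) < q := by exact_mod_cast hq
  have h0 : (0 : ℚ) ≤ ((flfr a p q).2 : ℚ) / q := by positivity
  have h1 : ((flfr a p q).2 : ℚ) / q < 1 := by
    rw [div_lt_one hq']; exact_mod_cast hlt
  symm; rw [Int.floor_eq_iff]; constructor <;> linarith

/-- The second component of `flfr` is `q` times the fractional part. [folklore] -/
theorem flfr_snd (a : ℤ) (p q : ℕ) (hq : 0 < q) :
    (((flfr a p q).2 : ℕ) : ℚ) / q = Int.fract ((a : ℚ) * p / q) := by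
  rw [Int.fract, ← flfr_fst a p q hq]
  linarith [(flfr_spec a p q hq).1]

/-- The jump of a term at `(t, y)`: `w_T · 1[y ⊵ t]`. [folklore] -/
def jumpQ (T : Term) (t y : ℚ) : ℤ :=
  match T.kind with
  | .yax => if t ≤ y then T.coef else 0
  | .axy => if t < y then -T.coef else 0
  | .ax => 0

/-- `y` has passed the jump point `t` of the term. [folklore] -/
def passedQ (T : Term) (t y : ℚ) : Prop :=
  match T.kind with
  | .yax => t ≤ y
  | .axy => t < y
  | .ax => False

/-- `passedQ` is decidable. [folklore] -/
instance (T : Term) (t y : ℚ) : Decidable (passedQ T t y) := by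
  unfold passedQ; cases T.kind <;> infer_instance

/-- `jumpQ` is the weight on the passed side. [folklore] -/
theorem jumpQ_eq_ite (T : Term) (t y : ℚ) :
    jumpQ T t y = if passedQ T t y then weight T else 0 := by
  rcases T with ⟨c, k, a⟩; cases k <;> simp [jumpQ, passedQ, weight]

/-- **Base/jump decomposition of a term** for `y ∈ [0, 1)`:
`T.eval x y = bPartF T ⌊a x⌋ + jumpQ T {a x} y`. [folklore] -/
theorem eval_eq_base_add_jump (T : Term) (x y : ℚ) (hy0 : 0 ≤ y) (hy1 : y < 1) :
    T.eval x y = bPartF T ⌊(T.a : ℚ) * x⌋ + jumpQ T (Int.fract ((T.a : ℚ) * x)) y := by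
  rcases T with ⟨c, k, a⟩
  set F := ⌊(a : ℚ) * x⌋ with hF
  have ht : (a : ℚ) * x = Int.fract ((a : ℚ) * x) + F := by rw [Int.fract]; ring
  set t := Int.fract ((a : ℚ) * x) with htdef
  have ht0 : 0 ≤ t := Int.fract_nonneg _
  have ht1 : t < 1 := Int.fract_lt_one _
  cases k with
  | yax =>
    simp only [Term.eval, bPartF, jumpQ]
    rw [show y - (a : ℚ) * x = (y - t) - (F : ℤ) by rw [ht]; ring, Int.floor_sub_intCast]
    split_ifs with h
    · rw [show ⌊y - t⌋ = 0 from Int.floor_eq_zero_iff.2 ⟨by linarith, by linarith⟩]; ring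
    · rw [show ⌊y - t⌋ = -1 from
        Int.floor_eq_iff.2 ⟨by push_cast; linarith, by push_cast; linarith⟩]
      ring
  | axy =>
    simp only [Term.eval, bPartF, jumpQ]
    rw [show (a : ℚ) * x - y = (F : ℤ) + (t - y) by rw [ht]; ring, Int.floor_intCast_add]
    split_ifs with h
    · rw [show ⌊t - y⌋ = -1 from
        Int.floor_eq_iff.2 ⟨by push_cast; linarith, by push_cast; linarith⟩]
      ring
    · rw [show ⌊t - y⌋ = 0 from Int.floor_eq_zero_iff.2 ⟨by linarith, by linarith⟩]; ring
  | ax => simp [Term.eval, bPartF, jumpQ, hF]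

/-! ### Soundness, II: the prefix bound -/

/-- **Prefix bound**: if the passed terms form a down-set of the list order, the jump sum is at
least
`minPrefixD`. [folklore] -/
theorem minPrefixD_le (P : Term → Prop) [DecidablePred P] :
    ∀ S : List DTerm, S.Pairwise (fun x y => P y.1 → P x.1) →
      minPrefixD S ≤ (S.map fun x => if P x.1 then weight x.1 else 0).sum
  | [], _ => le_rfl
  | x :: S, h => by
    rw [List.pairwise_cons] at h
    simp only [minPrefixD, List.map_cons, List.sum_cons]
    by_cases hx : P x.1
    · rw [if_pos hx]
      have := minPrefixD_le P S h.2
      omega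
    · rw [if_neg hx, zero_add]
      have h0 : (S.map fun x => if P x.1 then weight x.1 else 0).sum = 0 := by
        rw [List.sum_eq_zero]
        intro w hw
        rw [List.mem_map] at hw
        obtain ⟨z, hz, rfl⟩ := hw
        rw [if_neg fun hz' => hx (h.1 z hz hz')]
      rw [h0]; exact min_le_left _ _


/-! ### Soundness, III: keys at the left endpoint -/

/-- The type bit is `0` or `1`. [folklore] -/
theorem tbit_le_one (T : Term) : tbit T ≤ 1 := by
  unfold tbit; cases T.kind <;> simp

/-- **Monotonicity at `u`**: along the `keyU` order the passed terms form a down-set. [folklore] -/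
theorem passed_mono_U {p q : ℕ} (hq : 0 < q) {T₁ T₂ : Term} (h1 : isY T₁ = true)
    (hk : keyU p q T₁ ≤ keyU p q T₂) (y : ℚ)
    (h : passedQ T₂ (Int.fract ((T₂.a : ℚ) * p / q)) y) :
    passedQ T₁ (Int.fract ((T₁.a : ℚ) * p / q)) y := by
  rw [← flfr_snd _ p q hq] at h ⊢
  have hq' : (0 : ℚ) < q := by exact_mod_cast hq
  have mono : ∀ {m n : ℕ}, m ≤ n → (m : ℚ) / q ≤ (n : ℚ) / q := fun hle =>
    div_le_div_of_nonneg_right (by exact_mod_cast hle) hq'.le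
  have smono : ∀ {m n : ℕ}, m < n → (m : ℚ) / q < (n : ℚ) / q := fun hlt =>
    div_lt_div_of_pos_right (by exact_mod_cast hlt) hq'
  rcases T₁ with ⟨c₁, k₁, a₁⟩
  rcases T₂ with ⟨c₂, k₂, a₂⟩
  cases k₁ <;> cases k₂ <;>
    simp only [passedQ, isY, keyU, tbit, add_zero, Bool.false_eq_true] at h h1 hk ⊢
  · exact (mono (by omega)).trans h
  · exact ((mono (by omega)).trans_lt h).le
  · exact (smono (by omega)).trans_le h
  · exact (mono (by omega)).trans_lt h

/-- A decorated term carries the keys of the current point. [folklore] -/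
def DecoOK (p q : ℕ) (x : DTerm) : Prop := x.2.1 = keyU p q x.1 ∧ x.2.2 = keyP p q x.1

/-- Decoration keeps the term. [folklore] -/
theorem deco_fst (p q : ℕ) (x : DTerm) : (deco p q x).1 = x.1 := rfl

/-- Decoration computes the two keys. [folklore] -/
theorem deco_ok (p q : ℕ) (x : DTerm) : DecoOK p q (deco p q x) := by
  refine ⟨rfl, ?_⟩
  simp only [deco, keyP, tpn]

/-- `leU` is total. [folklore] -/
instance : Std.Total leU := ⟨fun x y => le_total x.2.1 y.2.1⟩
/-- `leU` is transitive. [folklore] -/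
instance : IsTrans DTerm leU := ⟨fun _ _ _ => le_trans⟩
/-- `leP` is total. [folklore] -/
instance : Std.Total leP := ⟨fun x y => le_total x.2.2 y.2.2⟩
/-- `leP` is transitive. [folklore] -/
instance : IsTrans DTerm leP := ⟨fun _ _ _ => le_trans⟩

end Sweep

end Summit.KontsevichZagierPeriods.Zeta5Search
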